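import Mathlib
import Literature.AlgebraicGeometry.Resolution.VertexDissolution
import Literature.AlgebraicGeometry.Resolution.PolygonChartTransport
import HarnessLib

/-!
# Solvable vertices: witnesses, shear invariance, and pull-back through the origin chart

Topic: `Literature/AlgebraicGeometry/Resolution`. Propagation of Hironaka's `v`-preparedness
along a point blow-up (Cossart–Jannsen–Saito, LNM 2270, Lemma 12.1 (4): "if `(f, y, u)` is
prepared at `w⁻(f, y, u)`, then `(f′, y′, (u₁, u′₂))` is `v`-prepared"; Lemma 13.6: the vertex
`v` and its initial forms are unchanged by `ũ₂ = u₂ − φ u₁`; Cossart–Piltant 2008, proof of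
Lemma 4.5, p. 12: "`Δ(E′; u₁, u₂/u₁; z/u₁)` is prepared", "`v` … is not solvable in
`Δ(E; u₁, v₂; z)`"). In the language of `WeightedInitialForms.IsSolvableAt` (all initial forms
of `J` along a supporting line, in the degree `n = μ w₀` of `Y^μ`, are multiples of
`(Y + λ U^v)^μ`) we PROVE (no facts):

* `IsSolvableAt.exists_sub_mem` / `isSolvableAt_of_forall_exists_sub_mem` — **element form of
  solvability**: `v` is solvable by `λ̄` iff every `f ∈ J ∩ F_n` satisfies
  `f ≡ a · (y + λ u^v)^μ mod F_{n+1}` for some `a ∈ R` (`λ` any lift of `λ̄`);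
* `isSolvableAt_shiftU₂_iff` — **shear invariance** for weights with `W₂ < W₁`
  (CJS Lemma 13.6);
* `isSolvableAt_of_chart` — **solvability descends from the weak transform**: at the origin of
  the `u₁`-chart (rational point: the residue map is surjective), if the weak transform
  `J′ = (J R′ : u₁^μ)` is solvable at the integral point `(v₁ + v₂ − 1, v₂)` for the positive
  weight `W′`, then `J` is solvable at `(v₁, v₂)` for the pulled-back weight (contraction
  `mem_weightedIdealW_of_map_mem`); contrapositively, unsolvability at `x` gives
  `v′`-preparedness at `x′` (CJS Lemma 12.1 (4)).

## Sources

* V. Cossart, U. Jannsen, S. Saito, LNM 2270 (2020), Lemma 12.1 (4), Lemma 13.6, Def. 8.11.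
  [CossartJannsenSaito2020]
* V. Cossart, O. Piltant, J. Algebra 320 (2008), proof of Lemma 4.5, p. 12. [CossartPiltant2008]
* H. Hironaka, J. Math. Kyoto Univ. 7 (1967), §3. [Hironaka1967]
-/

noncomputable section

open IsLocalRing MvPolynomial

namespace Literature.AlgebraicGeometry.Resolution

universe u

/-! ## Element form of solvability -/

section Witness

variable {R : Type u} [CommRing R] [IsRegularLocalRing R] (c : Fin 3 → R)
  (hgen : Ideal.span {c 0, c 1, c 2} = maximalIdeal R) (hdim : ringKrullDim R = 3)

omit [IsRegularLocalRing R] in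
/-- The lifted shifted power `a (Y + λ X^v)^μ ∈ R[X]` is `w`-homogeneous of weight `μ w₀`.
[folklore] -/
theorem isWeightedHomogeneous_C_mul_shift_pow {w : Fin 3 → ℕ} {v : Fin 3 →₀ ℕ}
    (hv : Finsupp.weight w v = w 0) (a lam : R) (μ : ℕ) :
    (C a * (X 0 + C lam * monomial v 1) ^ μ : MvPolynomial (Fin 3) R).IsWeightedHomogeneous w
      (μ * w 0) := by
  have h2 := isWeightedHomogeneous_shift_pow (k := R) hv lam μ
  have h3 : (C a : MvPolynomial (Fin 3) R).IsWeightedHomogeneous w 0 := isWeightedHomogeneous_C _ _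
  have := h3.mul h2
  rwa [zero_add] at this

omit [IsRegularLocalRing R] in
/-- Evaluation of the lifted shifted power: `(a (Y + λ X^v)^μ)(c) = a (c₀ + λ c^v)^μ`. [folklore] -/
theorem eval_C_mul_shift_pow (a lam : R) (v : Fin 3 →₀ ℕ) (μ : ℕ) :
    eval c (C a * (X 0 + C lam * monomial v 1) ^ μ) = a * (c 0 + lam * monom3 c v) ^ μ := by
  rw [map_mul, eval_C, map_pow, map_add, eval_X, map_mul, eval_C, eval_monomial_eq_monom3, one_mul]

omit [IsRegularLocalRing R] in
/-- Reduction of the lifted shifted power. [folklore] -/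
theorem map_residue_C_mul_shift_pow [IsLocalRing R] (a lam : R) (v : Fin 3 →₀ ℕ) (μ : ℕ) :
    MvPolynomial.map (residue R) (C a * (X 0 + C lam * monomial v 1) ^ μ) =
      C (residue R a) * (X 0 + C (residue R lam) * monomial v 1) ^ μ := by
  rw [map_mul, map_C, map_pow, map_add, map_X, map_mul, map_C, map_monomial, map_one]

include hgen hdim in
/-- **Solvability, element form (⇒)**: if `v` is solvable by `λ̄` along the weight `w` in degree
`n = μ w₀` and `λ` lifts `λ̄`, then every `f ∈ J ∩ F_n` is `≡ a (c₀ + λ c^v)^μ mod F_{n+1}` for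
some `a ∈ R`. [cite: CossartPiltant2008, §4 p. 11] [cite: CossartJannsenSaito2020, Def. 8.11] -/
theorem IsSolvableAt.exists_sub_mem {J : Ideal R} {w : Fin 3 → ℕ} (hw : ∀ i, 0 < w i) {n μ : ℕ}
    (hn : n = μ * w 0) {v : Fin 3 →₀ ℕ} {lam : R}
    (hsolv : IsSolvableAt c J w n μ v (residue R lam)) {f : R} (hfJ : f ∈ J)
    (hfn : f ∈ weightedIdealW c w n) :
    ∃ a : R, f - a * (c 0 + lam * monom3 c v) ^ μ ∈ weightedIdealW c w (n + 1) := by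
  obtain ⟨-, hvw, hsol⟩ := hsolv
  obtain ⟨a, ha⟩ := hsol f hfJ hfn
  obtain ⟨G, hG, hGmap, hGrem⟩ := isInForm_inForm c hgen hdim hw hfn
  obtain ⟨a', ha'⟩ := residue_surjective (R := R) a
  set Gt : MvPolynomial (Fin 3) R := C a' * (X 0 + C lam * monomial v 1) ^ μ with hGt
  have hGt_map : MvPolynomial.map (residue R) Gt = inForm c w n f := by
    rw [ha, hGt, map_residue_C_mul_shift_pow, ha']
  have hGt_hom : Gt.IsWeightedHomogeneous w n := by
    rw [hn]; exact isWeightedHomogeneous_C_mul_shift_pow hvw a' lam μ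
  have hdiffc : ∀ m, (G - Gt).coeff m ∈ maximalIdeal R := by
    rw [← map_residue_eq_zero_iff, map_sub, hGmap, hGt_map, sub_self]
  have hdiff : eval c (G - Gt) ∈ weightedIdealW c w (n + 1) :=
    eval_mem_succ_of_coeff_mem c (span_range_eq_of_span_triple c hgen) hw
      (isWeightedHomogeneous_sub hG hGt_hom) hdiffc
  refine ⟨a', ?_⟩
  rw [← eval_C_mul_shift_pow c a' lam v μ]
  have : f - eval c Gt = (f - eval c G) + eval c (G - Gt) := by rw [map_sub]; ring
  rw [this]; exact Ideal.add_mem _ hGrem hdiff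

include hgen hdim in
/-- **Solvability, element form (⇐)**: if every `f ∈ J ∩ F_n` is `≡ a_f (c₀ + λ c^v)^μ mod
F_{n+1}` (with `v₀ = 0`, `⟨w, v⟩ = w₀`, `n = μ w₀`), then `v` is solvable by the residue of `λ`.
[cite: CossartPiltant2008, §4 p. 11] [cite: CossartJannsenSaito2020, Def. 8.11] -/
theorem isSolvableAt_of_forall_exists_sub_mem {J : Ideal R} {w : Fin 3 → ℕ} (hw : ∀ i, 0 < w i)
    {n μ : ℕ} (hn : n = μ * w 0) {v : Fin 3 →₀ ℕ} (hv0 : v 0 = 0)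
    (hvw : Finsupp.weight w v = w 0) {lam : R}
    (h : ∀ f ∈ J, f ∈ weightedIdealW c w n →
      ∃ a : R, f - a * (c 0 + lam * monom3 c v) ^ μ ∈ weightedIdealW c w (n + 1)) :
    IsSolvableAt c J w n μ v (residue R lam) := by
  refine ⟨hv0, hvw, fun f hfJ hfn => ?_⟩
  obtain ⟨a, ha⟩ := h f hfJ hfn
  refine ⟨residue R a, ?_⟩
  have hIn : IsInForm c w n f (C (residue R a) * (X 0 + C (residue R lam) * monomial v 1) ^ μ) := by
    refine ⟨C a * (X 0 + C lam * monomial v 1) ^ μ, ?_, map_residue_C_mul_shift_pow a lam v μ, ?_⟩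
    · rw [hn]; exact isWeightedHomogeneous_C_mul_shift_pow hvw a lam μ
    · rw [eval_C_mul_shift_pow]; exact ha
  exact (hIn.eq_inForm c hgen hdim hw).symm

end Witness

/-! ## Shear invariance (CJS Lemma 13.6) -/

section Shear

variable {R : Type u} [CommRing R]

/-- The sheared system `(y, u₁, u₂ + φ u₁)`. [cite: CossartJannsenSaito2020, Lemma 13.6] -/
def shiftU₂ (c : Fin 3 → R) (phi : R) : Fin 3 → R := ![c 0, c 1, c 2 + phi * c 1]

/-- Component. [folklore] -/
@[simp] theorem shiftU₂_zero (c : Fin 3 → R) (phi : R) : shiftU₂ c phi 0 = c 0 := rfl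
/-- Component. [folklore] -/
@[simp] theorem shiftU₂_one (c : Fin 3 → R) (phi : R) : shiftU₂ c phi 1 = c 1 := rfl
/-- Component. [folklore] -/
@[simp] theorem shiftU₂_two (c : Fin 3 → R) (phi : R) : shiftU₂ c phi 2 = c 2 + phi * c 1 := rfl

/-- **The weighted ideals are shear invariant** for `W₂ ≤ W₁`. [cite: CossartJannsenSaito2020, Lemma 13.6] -/
theorem weightedIdealW_shiftU₂ (c : Fin 3 → R) (phi : R) (W : Fin 3 → ℕ) (hW : W 2 ≤ W 1) (ρ : ℕ) :
    weightedIdealW (shiftU₂ c phi) W ρ = weightedIdealW c W ρ := by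
  have := weightedIdealW_shift_u₂ (c 0) (c 1) (c 2) phi W hW ρ
  rw [eta_fin_three] at this
  exact this

/-- The maximal ideal is still generated. [folklore] -/
theorem span_triple_shiftU₂ (c : Fin 3 → R) (phi : R) :
    Ideal.span {shiftU₂ c phi 0, shiftU₂ c phi 1, shiftU₂ c phi 2} = Ideal.span {c 0, c 1, c 2} := by
  simp only [shiftU₂_zero, shiftU₂_one, shiftU₂_two]
  apply le_antisymm
  · rw [Ideal.span_le]
    rintro x (rfl | rfl | rfl)
    · exact Ideal.subset_span (by simp)
    · exact Ideal.subset_span (by simp)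
    · exact Ideal.add_mem _ (Ideal.subset_span (by simp))
        (Ideal.mul_mem_left _ _ (Ideal.subset_span (by simp)))
  · rw [Ideal.span_le]
    rintro x (rfl | rfl | rfl)
    · exact Ideal.subset_span (by simp)
    · exact Ideal.subset_span (by simp)
    · have : c 2 = (c 2 + phi * c 1) - phi * c 1 := by ring
      rw [SetLike.mem_coe, this]
      exact Ideal.sub_mem _ (Ideal.subset_span (by simp))
        (Ideal.mul_mem_left _ _ (Ideal.subset_span (by simp)))

/-- **Substitution estimate for the shear**: for `W₂ < W₁` and `G` homogeneous of weight `n`,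
`G(y, u₁, u₂) − G(y, u₁, u₂ + φ u₁) ∈ F_{n+1}`. [cite: CossartJannsenSaito2020, Lemma 13.6] -/
theorem eval_sub_eval_shiftU₂_mem (c : Fin 3 → R) (phi : R) {w : Fin 3 → ℕ} (hw : w 2 < w 1)
    {n : ℕ} {G : MvPolynomial (Fin 3) R} (hG : G.IsWeightedHomogeneous w n) :
    eval c G - eval (shiftU₂ c phi) G ∈ weightedIdealW c w (n + 1) := by
  classical
  set t := phi * c 1 with ht
  have htmem : t ∈ weightedIdealW c w (w 2 + 1) :=
    Ideal.mul_mem_left _ _ (weightedIdealW_antitone c w hw (apply_mem_weightedIdealW c w 1))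
  have ht'' : t ∈ weightedIdealW c w (w 2) := weightedIdealW_antitone c w (Nat.le_succ _) htmem
  rw [G.as_sum, map_sum, map_sum, ← Finset.sum_sub_distrib]
  refine Ideal.sum_mem _ fun m hm => ?_
  rw [eval_monomial_eq_monom3, eval_monomial_eq_monom3, ← mul_sub]
  refine Ideal.mul_mem_left _ _ ?_
  have hwm : Finsupp.weight w m = n := hG (mem_support_iff.mp hm)
  have hsplit : monom3 c m - monom3 (shiftU₂ c phi) m =
      (c 0 ^ m 0 * c 1 ^ m 1) * (c 2 ^ m 2 - (c 2 + t) ^ m 2) := by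
    simp only [monom3, shiftU₂_zero, shiftU₂_one, shiftU₂_two, ht]; ring
  rw [hsplit]
  have hwt : n = (m 0 * w 0 + m 1 * w 1) + m 2 * w 2 := by
    rw [← hwm, Finsupp.weight_apply, Finsupp.sum_fintype _ _ (by simp)]
    simp only [Fin.sum_univ_three, smul_eq_mul]
  have hpow : c 2 ^ m 2 - (c 2 + t) ^ m 2 ∈ weightedIdealW c w (m 2 * w 2 + 1) := by
    rcases Nat.eq_zero_or_pos (m 2) with h0 | hpos
    · rw [h0, pow_zero, pow_zero, sub_self]; exact Ideal.zero_mem _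
    · obtain ⟨k, hk⟩ : ∃ k, m 2 = k + 1 := ⟨m 2 - 1, by omega⟩
      have key := (Commute.all (c 2) (c 2 + t)).geom_sum₂_mul (m 2)
      rw [← key]
      have hsum : (Finset.range (m 2)).sum (fun i => c 2 ^ i * (c 2 + t) ^ (m 2 - 1 - i)) ∈
          weightedIdealW c w (k * w 2) := by
        refine Ideal.sum_mem _ fun i hi => ?_
        have hi' := Finset.mem_range.mp hi
        have h1 : c 2 ^ i ∈ weightedIdealW c w (i * w 2) :=
          pow_mem_weightedIdealW c w (apply_mem_weightedIdealW c w 2) i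
        have h2 : (c 2 + t) ^ (m 2 - 1 - i) ∈ weightedIdealW c w ((m 2 - 1 - i) * w 2) :=
          pow_mem_weightedIdealW c w (Ideal.add_mem _ (apply_mem_weightedIdealW c w 2) ht'') _
        have := weightedIdealW_mul_le c w _ _ (Ideal.mul_mem_mul h1 h2)
        refine weightedIdealW_antitone c w ?_ this
        have : i + (m 2 - 1 - i) = k := by omega
        rw [← add_mul, this]
      have hdiff : c 2 - (c 2 + t) = -t := by ring
      rw [hdiff]
      have := weightedIdealW_mul_le c w _ _ (Ideal.mul_mem_mul hsum
        ((weightedIdealW c w _).neg_mem htmem))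
      refine weightedIdealW_antitone c w ?_ this
      rw [hk]; ring_nf; omega
  have hu : c 0 ^ m 0 * c 1 ^ m 1 ∈ weightedIdealW c w (m 0 * w 0 + m 1 * w 1) :=
    weightedIdealW_mul_le c w _ _ (Ideal.mul_mem_mul
      (pow_mem_weightedIdealW c w (apply_mem_weightedIdealW c w 0) _)
      (pow_mem_weightedIdealW c w (apply_mem_weightedIdealW c w 1) _))
  have := weightedIdealW_mul_le c w _ _ (Ideal.mul_mem_mul hu hpow)
  refine weightedIdealW_antitone c w ?_ this
  rw [hwt]; omega

/-- **Initial forms are shear invariant** for `W₂ < W₁` (one direction). [cite: CossartJannsenSaito2020, Lemma 13.6] -/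
theorem IsInForm.shear [IsLocalRing R] {c : Fin 3 → R} {w : Fin 3 → ℕ} (hw : w 2 < w 1) (phi : R)
    {n : ℕ} {f : R} {P : MvPolynomial (Fin 3) (ResidueField R)} (h : IsInForm c w n f P) :
    IsInForm (shiftU₂ c phi) w n f P := by
  obtain ⟨G, hG, hGP, hGrem⟩ := h
  refine ⟨G, hG, hGP, ?_⟩
  rw [weightedIdealW_shiftU₂ c phi w hw.le]
  have : f - eval (shiftU₂ c phi) G = (f - eval c G) + (eval c G - eval (shiftU₂ c phi) G) := by
    ring
  rw [this]
  exact Ideal.add_mem _ hGrem (eval_sub_eval_shiftU₂_mem c phi hw hG)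

/-- Shearing back. [folklore] -/
theorem shiftU₂_shiftU₂_neg (c : Fin 3 → R) (phi : R) : shiftU₂ (shiftU₂ c phi) (-phi) = c := by
  funext i
  fin_cases i
  · rfl
  · rfl
  · show (c 2 + phi * c 1) + -phi * c 1 = c 2
    ring

/-- **Initial forms are shear invariant** for `W₂ < W₁`. [cite: CossartJannsenSaito2020, Lemma 13.6] -/
theorem isInForm_shiftU₂_iff [IsLocalRing R] (c : Fin 3 → R) {w : Fin 3 → ℕ} (hw : w 2 < w 1)
    (phi : R) (n : ℕ) (f : R) (P : MvPolynomial (Fin 3) (ResidueField R)) :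
    IsInForm (shiftU₂ c phi) w n f P ↔ IsInForm c w n f P := by
  refine ⟨fun h => ?_, IsInForm.shear hw phi⟩
  have := h.shear hw (-phi)
  rwa [shiftU₂_shiftU₂_neg] at this

variable [IsRegularLocalRing R] (c : Fin 3 → R)
  (hgen : Ideal.span {c 0, c 1, c 2} = maximalIdeal R) (hdim : ringKrullDim R = 3)

include hgen hdim in
/-- `inForm` is shear invariant for `W₂ < W₁` (positive weights, `f ∈ F_n`). [cite: CossartJannsenSaito2020, Lemma 13.6] -/
theorem inForm_shiftU₂ {w : Fin 3 → ℕ} (hwpos : ∀ i, 0 < w i) (hw : w 2 < w 1) (phi : R) {n : ℕ}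
    {f : R} (hf : f ∈ weightedIdealW c w n) :
    inForm (shiftU₂ c phi) w n f = inForm c w n f := by
  have hgen' : Ideal.span {shiftU₂ c phi 0, shiftU₂ c phi 1, shiftU₂ c phi 2} = maximalIdeal R := by
    rw [span_triple_shiftU₂]; exact hgen
  have h := (isInForm_inForm c hgen hdim hwpos hf).shear hw phi
  exact (h.eq_inForm (shiftU₂ c phi) hgen' hdim hwpos).symm

include hgen hdim in
/-- **Solvability is shear invariant** for `W₂ < W₁` (CJS Lemma 13.6: "`v` … and the initial
forms at it are not affected by the transformation `(f, y, u) → (f, y, (u₁, ũ₂))`"; CoP1 p. 12).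
[cite: CossartJannsenSaito2020, Lemma 13.6] [cite: CossartPiltant2008, proof of Lemma 4.5, p. 12] -/
theorem isSolvableAt_shiftU₂_iff {J : Ideal R} {w : Fin 3 → ℕ} (hwpos : ∀ i, 0 < w i) (hw : w 2 < w 1)
    (phi : R) {n μ : ℕ} {v : Fin 3 →₀ ℕ} {lam : ResidueField R} :
    IsSolvableAt (shiftU₂ c phi) J w n μ v lam ↔ IsSolvableAt c J w n μ v lam := by
  unfold IsSolvableAt
  refine and_congr_right fun _ => and_congr_right fun _ => ?_
  refine forall_congr' fun f => forall_congr' fun hfJ => ?_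
  rw [weightedIdealW_shiftU₂ c phi w hw.le]
  refine forall_congr' fun hfn => ?_
  rw [inForm_shiftU₂ c hgen hdim hwpos hw phi hfn]

end Shear

/-! ## Solvability descends from the weak transform (origin chart) -/

section Chart

variable {R R' : Type u} [CommRing R] [CommRing R'] (φ : R →+* R') {c : Fin 3 → R}
  {c' : Fin 3 → R'} (h₁ : c' 1 = φ (c 1)) (h₀ : φ (c 0) = φ (c 1) * c' 0)
  (h₂ : φ (c 2) = φ (c 1) * c' 2) (W' : Fin 3 → ℕ)

include h₁ h₂ in
/-- The shift monomial goes up: `φ(u₁^{v₁} u₂^{v₂}) · (φ u₁)^{?}`… precisely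
`φ u₁ · c′^{vexp (v₁ + v₂ − 1) v₂} = φ(c^{vexp v₁ v₂})` when `v₁ + v₂ ≥ 1`. [folklore] -/
theorem map_monom3_vexp {v₁ v₂ : ℕ} (hv : 1 ≤ v₁ + v₂) :
    φ (c 1) * monom3 c' (vexp (v₁ + v₂ - 1) v₂) = φ (monom3 c (vexp v₁ v₂)) := by
  rw [monom3_vexp, monom3_vexp, map_mul, map_pow, map_pow, h₂, h₁, mul_pow]
  obtain ⟨k, hk⟩ : ∃ k, v₁ + v₂ = k + 1 := ⟨v₁ + v₂ - 1, by omega⟩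
  have : v₁ + v₂ - 1 = k := by omega
  rw [this]
  have hk' : φ (c 1) ^ v₁ * φ (c 1) ^ v₂ = φ (c 1) * φ (c 1) ^ k := by
    rw [← pow_add, hk, pow_succ]; ring
  calc φ (c 1) * (φ (c 1) ^ k * c' 2 ^ v₂)
      = (φ (c 1) * φ (c 1) ^ k) * c' 2 ^ v₂ := by ring
    _ = (φ (c 1) ^ v₁ * φ (c 1) ^ v₂) * c' 2 ^ v₂ := by rw [hk']
    _ = φ (c 1) ^ v₁ * (φ (c 1) ^ v₂ * c' 2 ^ v₂) := by ring

variable [IsRegularLocalRing R] [IsRegularLocalRing R']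
  (hgen : Ideal.span {c 0, c 1, c 2} = maximalIdeal R) (hdim : ringKrullDim R = 3)
  (hgen' : Ideal.span {c' 0, c' 1, c' 2} = maximalIdeal R') (hdim' : ringKrullDim R' = 3)
  (hW' : ∀ i, 0 < W' i)

include h₁ h₀ h₂ hgen hdim hgen' hdim' hW' in
/-- **Solvability descends through the origin chart** (CJS Lemma 12.1 (4), contrapositive form):
let `W` be the pull-back of the positive weight `W′`, `n′ = μ W′₀`, `n = n′ + μ W′₁ = μ W₀`. If
the residue map `k(x) → k(x′)` is surjective (e.g. `x′` rational) and the weak transform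
`J′ = (J R′ : (φ u₁)^μ)` of `J ⊆ 𝔪^μ` is solvable at `vexp (v₁ + v₂ − 1) v₂` by `λ̄′` along `W′`
in degree `n′`, then `J` is solvable at `vexp v₁ v₂` along `W` in degree `n` by any `λ̄` with
`ψ(λ̄) = λ̄′`. [cite: CossartJannsenSaito2020, Lemma 12.1 (4)] [cite: CossartPiltant2008, proof of Lemma 4.5, p. 12] -/
theorem isSolvableAt_of_chart [IsLocalHom φ] (hψ : Function.Surjective (ResidueField.map φ))
    {J : Ideal R} {μ : ℕ} (hJμ : J ≤ maximalIdeal R ^ μ) {v₁ v₂ : ℕ} (hv : 1 ≤ v₁ + v₂)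
    (hvW : Finsupp.weight (pullbackWeight W') (vexp v₁ v₂) = pullbackWeight W' 0)
    {lam : R}
    (hsolv' : IsSolvableAt c' ((J.map φ).colon {φ (c 1) ^ μ}) W' (μ * W' 0) μ
      (vexp (v₁ + v₂ - 1) v₂) (residue R' (φ lam))) :
    IsSolvableAt c J (pullbackWeight W') (μ * pullbackWeight W' 0) μ (vexp v₁ v₂) (residue R lam) := by
  have hW : ∀ i, 0 < pullbackWeight W' i := by
    intro i
    fin_cases i
    · change 0 < W' 0 + W' 1; have := hW' 0; omega
    · exact hW' 1
    · change 0 < W' 2 + W' 1; have := hW' 2; omega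
  have hgenr := span_range_eq_of_span_triple c hgen
  have hgenr' := span_range_eq_of_span_triple c' hgen'
  refine isSolvableAt_of_forall_exists_sub_mem c hgen hdim hW rfl (by simp) hvW fun f hfJ hfn => ?_
  -- `φ f = (φ u₁)^μ g` with `g ∈ J′ ∩ F′_{μ W′₀}`
  obtain ⟨g, hg⟩ := exists_eq_pow_mul_of_mem_pow φ h₀ h₂ hgen (hJμ hfJ)
  have hgJ' : g ∈ (J.map φ).colon {φ (c 1) ^ μ} := by
    rw [Submodule.mem_colon_singleton, smul_eq_mul, mul_comm, ← hg]
    exact Ideal.mem_map_of_mem _ hfJ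
  have hlev : μ * pullbackWeight W' 0 = μ * W' 0 + μ * W' 1 := by
    change μ * (W' 0 + W' 1) = _; ring
  have hgn : g ∈ weightedIdealW c' W' (μ * W' 0) := by
    refine mem_weightedIdealW_of_pow_mul_mem_map φ h₁ h₀ h₂ W' hgen' hdim' hW'
      (J := Ideal.span {f}) (μ := μ) ?_ ?_
    · rw [Ideal.span_le, Set.singleton_subset_iff, ← hlev]; exact hfn
    · rw [← hg]; exact Ideal.mem_map_of_mem _ (Ideal.subset_span rfl)
  -- solvability at `x′`, element form
  obtain ⟨a', ha'⟩ := IsSolvableAt.exists_sub_mem c' hgen' hdim' hW' rfl hsolv' hgJ' hgn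
  -- choose `a ∈ R` with the same residue as `a′`
  obtain ⟨abar, habar⟩ := hψ (residue R' a')
  obtain ⟨a, ha⟩ := residue_surjective (R := R) abar
  have haa' : a' - φ a ∈ maximalIdeal R' := by
    rw [← residue_eq_zero_iff, map_sub, ← habar, ← ha, ResidueField.map_residue, sub_self]
  refine ⟨a, ?_⟩
  -- `(φ u₁)^μ (c′₀ + φλ c′^{v′})^μ = φ((c₀ + λ c^v)^μ)`
  have hpow : φ (c 1) ^ μ * (c' 0 + φ lam * monom3 c' (vexp (v₁ + v₂ - 1) v₂)) ^ μ =
      φ ((c 0 + lam * monom3 c (vexp v₁ v₂)) ^ μ) := by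
    rw [← mul_pow, map_pow, mul_add, ← h₀, map_add, map_mul, ← map_monom3_vexp φ h₁ h₂ hv]
    ring
  -- contraction
  refine mem_weightedIdealW_of_map_mem φ h₁ h₀ h₂ W' hgenr hgen' hdim' hW' ?_
  have hsplit : φ (f - a * (c 0 + lam * monom3 c (vexp v₁ v₂)) ^ μ) =
      φ (c 1) ^ μ * (g - a' * (c' 0 + φ lam * monom3 c' (vexp (v₁ + v₂ - 1) v₂)) ^ μ) +
        (a' - φ a) * (φ (c 1) ^ μ * (c' 0 + φ lam * monom3 c' (vexp (v₁ + v₂ - 1) v₂)) ^ μ) := by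
    rw [map_sub, map_mul, hg, ← hpow]; ring
  rw [hsplit, hlev]
  refine Ideal.add_mem _ ?_ ?_
  · -- `(φ u₁)^μ · F′_{μW′₀ + 1} ⊆ F′_{μW′₀ + μW′₁ + 1}`
    have hmon : φ (c 1) ^ μ ∈ weightedIdealW c' W' (μ * W' 1) := by
      have : φ (c 1) ^ μ = monom3 c' (Finsupp.single 1 μ) := by simp [monom3, h₁]
      rw [this]
      refine monomial_mem_weightedIdealW c' W' ?_
      rw [Finsupp.weight_apply, Finsupp.sum_single_index (by simp), smul_eq_mul]
    have := weightedIdealW_mul_le c' W' _ _ (Ideal.mul_mem_mul hmon ha')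
    refine weightedIdealW_antitone c' W' ?_ this
    omega
  · -- `𝔪′ · F′_{n} ⊆ F′_{n+1}`
    have hmem : φ (c 1) ^ μ * (c' 0 + φ lam * monom3 c' (vexp (v₁ + v₂ - 1) v₂)) ^ μ ∈
        weightedIdealW c' W' (μ * W' 0 + μ * W' 1) := by
      rw [hpow, ← hlev]
      refine map_weightedIdealW_le φ h₁ h₀ h₂ W' _ (Ideal.mem_map_of_mem _ ?_)
      have hbase : c 0 + lam * monom3 c (vexp v₁ v₂) ∈
          weightedIdealW c (pullbackWeight W') (pullbackWeight W' 0) :=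
        Ideal.add_mem _ (apply_mem_weightedIdealW c _ 0)
          (Ideal.mul_mem_left _ _ (monomial_mem_weightedIdealW c _ hvW.ge))
      exact pow_mem_weightedIdealW c _ hbase μ
    have := maximalIdeal_mul_weightedIdealW_le c' W' hW' hgenr' _ (Ideal.mul_mem_mul haa' hmem)
    exact this

end Chart

end Literature.AlgebraicGeometry.Resolution
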